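import Mathlib
import Summits.NavierStokesRegularity.NavierStokesRegularity.Theses.CertifiedBlowup

/-!
# Strategist sketch — crux stmt-NavierStokesRegularity-0727 `CertifiedBlowupAxisymBlowup`

Part A: the typed split  C ⇐ ClayOrBlowup ∧ ¬AX  with its glue PROVED.
Part B: typed signatures used in STRATEGY-CENSUS.md (Transfer / Strengthen / Decomposition /
Negation attempts). Nothing here is proposed to the tree from this file.
-/

set_option linter.dupNamespace false

namespace Summit.NavierStokesRegularity.NavierStokesRegularity.Cruxes.CertifiedBlowupAxisymBlowup.Strategist

open Set Filter
open Literature.Analysis.FluidPDE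

local notation "ℝ³" => EuclideanSpace ℝ (Fin 3)

/-! ## Part A — decomposition through the wall -/

/-- Sub₁ (bookkeeping, provable now by the argument of
`Theorems/TypeICertificateLadderNoBlowupToClay.lean`): datum-wise Clay dichotomy — every Clay
datum either has a global classical bounded-energy solution or generates a maximal
Leray–Hopf classical solution with finite lifespan. -/
def ClayOrBlowup : Prop :=
  ∀ ν : ℝ, 0 < ν → ∀ u₀ : ℝ³ → ℝ³, ContDiff ℝ (⊤ : ℕ∞) u₀ → VectorCalculus.IsDivFree u₀ →
    HasRapidSpatialDecay u₀ →
      (∃ (u : ℝ → ℝ³ → ℝ³) (p : ℝ → ℝ³ → ℝ),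
          IsClassicalNSSolutionOn (Ici 0) ν 0 u p ∧ u 0 = u₀ ∧ HasBoundedEnergy u) ∨
      (∃ T : ℝ, 0 < T ∧ ∃ (u : ℝ → ℝ³ → ℝ³) (p : ℝ → ℝ³ → ℝ),
          IsMaximalSmoothSolution ν 0 u p T ∧ IsLerayHopfOn T ν 0 u₀ u ∧ u 0 = u₀)

/-- Sub₂ (the whole difficulty): the axisymmetric-with-swirl regularity conjecture ns.S25 fails. -/
def NotAxisymRegular : Prop :=
  ¬ Literature.Analysis.FluidPDE.AxisymmetricSwirlRegularity

/-- Glue, proved: `ClayOrBlowup → ¬AX → CertifiedBlowupAxisymBlowup`. -/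
theorem certifiedBlowupAxisymBlowup_of_subs :
    ClayOrBlowup → NotAxisymRegular →
      Summit.NavierStokesRegularity.NavierStokesRegularity.Theses.CertifiedBlowup.CertifiedBlowupAxisymBlowup := by
  intro hD hN
  by_contra hC
  apply hN
  intro ν hν u₀ hsm hdiv hdec hax
  rcases hD ν hν u₀ hsm hdiv hdec with ⟨u, p, hcl, h0, hE⟩ | ⟨T, hT, u, p, hmax, hLH, h0⟩
  · exact ⟨u, p, hcl, h0, hE⟩
  · exfalso
    apply hC
    refine ⟨ν, hν, T, hT, u, p, hmax, ?_, ?_, ?_⟩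
    · rw [h0]; exact hLH
    · rw [h0]; exact hdec
    · rw [h0]; exact hax

/-- Converse direction is already in tree (kill edge + proved X5b): `C → ¬AX`. -/
theorem notAxisymRegular_of_axisymBlowup
    (hC : Summit.NavierStokesRegularity.NavierStokesRegularity.Theses.CertifiedBlowup.CertifiedBlowupAxisymBlowup) :
    NotAxisymRegular := fun hAX =>
  Summit.NavierStokesRegularity.NavierStokesRegularity.Theses.CertifiedBlowup.CertifiedBlowupKillEdge_holds
    hAX Summit.NavierStokesRegularity.NavierStokesRegularity.Theses.CertifiedBlowup.BlowupClayUniqueness_holds hC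

/-! ## Part B — census signatures (typed only) -/

/-- STRENGTHEN S⁺₁ (barrier-dead): an axisymmetric blow-up at the Type I rate. Excluded by
KNSS2009 / SereginSverak2009 (in-tree named fact `knss_no_axisymmetric_typeI`, barrier
`Literature.Barriers.NavierStokesRegularity.AxisymmetricTypeIExclusion`). -/
def AxisymTypeIBlowup : Prop :=
  ∃ ν : ℝ, 0 < ν ∧ ∃ T : ℝ, 0 < T ∧ ∃ (u : ℝ → ℝ³ → ℝ³) (p : ℝ → ℝ³ → ℝ),
    IsMaximalSmoothSolution ν 0 u p T ∧ IsLerayHopfOn T ν 0 (u 0) u ∧ HasRapidSpatialDecay (u 0) ∧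
    IsAxisymmetric (u 0) ∧ IsTypeIBlowup u T

/-- The rotation by `π` about the `x 0`-axis, `(x₀,x₁,x₂) ↦ (x₀,−x₁,−x₂)`; with axisymmetry this is
Hou's parity class (u_r even, u_θ and u_z odd in z). -/
def rotX (x : ℝ³) : ℝ³ := WithLp.toLp 2 fun i => if i = 0 then x 0 else -(x i)

/-- STRENGTHEN S⁺₂ (more symmetry = fewer unstable directions; the CAP habit): an axisymmetric
blow-up from a datum that is moreover `rotX`-equivariant. Trivially implies C; buys only a smaller
unstable manifold inside the SAME certificate programme. -/
def AxisymRotXBlowup : Prop :=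
  ∃ ν : ℝ, 0 < ν ∧ ∃ T : ℝ, 0 < T ∧ ∃ (u : ℝ → ℝ³ → ℝ³) (p : ℝ → ℝ³ → ℝ),
    IsMaximalSmoothSolution ν 0 u p T ∧ IsLerayHopfOn T ν 0 (u 0) u ∧ HasRapidSpatialDecay (u 0) ∧
    IsAxisymmetric (u 0) ∧ ∀ x, u 0 (rotX x) = rotX (u 0 x)

theorem axisymBlowup_of_rotX (h : AxisymRotXBlowup) :
    Summit.NavierStokesRegularity.NavierStokesRegularity.Theses.CertifiedBlowup.CertifiedBlowupAxisymBlowup := by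
  obtain ⟨ν, hν, T, hT, u, p, h1, h2, h3, h4, -⟩ := h
  exact ⟨ν, hν, T, hT, u, p, h1, h2, h3, h4⟩

/-- TRANSFER first stub (MRRS implosion dictionary): a smooth, bounded, nontrivial axisymmetric
self-similar EULER blow-up profile `u(x,t) = (T−t)^{γ−1} U(x/(T−t)^γ)` with collapse exponent in
the viscosity-subcritical, finite-energy window `γ ∈ [2/5, 1/2)`:
`(1−γ)U + γ(y·∇)U + (U·∇)U + ∇P = 0`, `div U = 0`. Interior smooth self-similar Euler blow-up on
ℝ³ is itself open (Elgindi2021 is C^{1,α}; ChenHou2025 needs a boundary, γ ≈ 2.9). -/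
def EulerSelfSimilarAxisymProfileWindow : Prop :=
  ∃ γ : ℝ, 2 / 5 ≤ γ ∧ γ < 1 / 2 ∧ ∃ (U : ℝ³ → ℝ³) (P : ℝ³ → ℝ),
    ContDiff ℝ (⊤ : ℕ∞) U ∧ ContDiff ℝ (⊤ : ℕ∞) P ∧ IsAxisymmetric U ∧ VectorCalculus.IsDivFree U ∧
    (∃ y, U y ≠ 0) ∧ (∃ C : ℝ, ∀ y, ‖U y‖ ≤ C) ∧
    ∀ y, (1 - γ) • U y + γ • (fderiv ℝ U y) y + convect U U y + gradient P y = 0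

/-- NEGATION — the typed obstruction met when trying to build the counterexample (= prove AX):
every witness of C keeps swirl of size `ε`-NOT-small arbitrarily close to the axis arbitrarily
close to `T` (contrapositive shape of LeiZhang2017 Cor. 1.3 / Wei2016; in-tree named fact
`LeiZhang2017_logModulus_regularity`). A NECESSARY condition on witnesses only. -/
def SwirlPersistsAtAxis : Prop :=
  ∀ ν : ℝ, 0 < ν → ∀ T : ℝ, 0 < T → ∀ (u : ℝ → ℝ³ → ℝ³) (p : ℝ → ℝ³ → ℝ),
    IsMaximalSmoothSolution ν 0 u p T → IsLerayHopfOn T ν 0 (u 0) u → HasRapidSpatialDecay (u 0) →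
    IsAxisymmetric (u 0) →
      ∃ ε : ℝ, 0 < ε ∧ ∀ r₀ : ℝ, 0 < r₀ → ∀ t₀ ∈ Ico 0 T, ∃ t ∈ Ico t₀ T, ∃ x : ℝ³,
        cylRadius x < r₀ ∧ ε < |swirl (u t) x|

/-- DECOMPOSITION (dichotomy architecture) piece Q: qualitative axisymmetric regularity forces a
UNIFORM a-priori vorticity bound in terms of the datum's energy + enstrophy and the time
(Tao 2013 = arXiv:1108.1165, Thm 1.20-type compactness, restricted to the axisymmetric class). -/
def AxisymRegularityQuantifies : Prop :=
  Literature.Analysis.FluidPDE.AxisymmetricSwirlRegularity →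
    ∃ F : ℝ → ℝ → ℝ, ∀ T : ℝ, 0 < T → ∀ (u : ℝ → ℝ³ → ℝ³) (p : ℝ → ℝ³ → ℝ),
      IsClassicalNSSolutionOn (Icc 0 T) 1 0 u p → IsLerayHopfOn T 1 0 (u 0) u →
      HasRapidSpatialDecay (u 0) → IsAxisymmetric (u 0) → ∀ A : ℝ,
        (∫⁻ x, ‖u 0 x‖ₑ ^ 2) + (∫⁻ x, ‖fderiv ℝ (u 0) x‖ₑ ^ 2) ≤ ENNReal.ofReal A →
          ∀ t ∈ Icc 0 T, ∀ x, ‖curl (u t) x‖ ≤ F A T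

/-- DECOMPOSITION piece N (the new-content piece; blow-up-equivalent by Tao's converse): the
uniform bound fails — unbounded vorticity amplification at fixed datum size within fixed time,
realised by GLOBAL-IN-[0,T] classical axisymmetric solutions (each member a finite computation). -/
def AxisymNormInflation : Prop :=
  ∀ F : ℝ → ℝ → ℝ, ∃ T : ℝ, 0 < T ∧ ∃ (u : ℝ → ℝ³ → ℝ³) (p : ℝ → ℝ³ → ℝ),
    IsClassicalNSSolutionOn (Icc 0 T) 1 0 u p ∧ IsLerayHopfOn T 1 0 (u 0) u ∧
    HasRapidSpatialDecay (u 0) ∧ IsAxisymmetric (u 0) ∧ ∃ A : ℝ,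
      (∫⁻ x, ‖u 0 x‖ₑ ^ 2) + (∫⁻ x, ‖fderiv ℝ (u 0) x‖ₑ ^ 2) ≤ ENNReal.ofReal A ∧
        ∃ t ∈ Icc 0 T, ∃ x, F A T < ‖curl (u t) x‖

/-- The dichotomy architecture closes by pure logic: Q ∧ N ⇒ ¬AX (then `ClayOrBlowup` gives C). -/
theorem notAxisymRegular_of_quantified (hQ : AxisymRegularityQuantifies) (hN : AxisymNormInflation) :
    NotAxisymRegular := by
  intro hAX
  obtain ⟨F, hF⟩ := hQ hAX
  obtain ⟨T, hT, u, p, hcl, hLH, hdec, hax, A, hA, t, ht, x, hx⟩ := hN F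
  exact absurd (hF T hT u p hcl hLH hdec hax A hA t ht x) (not_le.mpr hx)

theorem axisymBlowup_of_quantified (hD : ClayOrBlowup) (hQ : AxisymRegularityQuantifies)
    (hN : AxisymNormInflation) :
    Summit.NavierStokesRegularity.NavierStokesRegularity.Theses.CertifiedBlowup.CertifiedBlowupAxisymBlowup :=
  certifiedBlowupAxisymBlowup_of_subs hD (notAxisymRegular_of_quantified hQ hN)

end Summit.NavierStokesRegularity.NavierStokesRegularity.Cruxes.CertifiedBlowupAxisymBlowup.Strategist
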